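import Literature.Analysis.FluidPDE.TypeIAncientMild
import Literature.Analysis.FluidPDE.OseenDuhamelJointContinuity
import Literature.Analysis.FluidPDE.OseenDuhamelSplit
import Literature.Analysis.FluidPDE.OseenKernelJointSmooth
import Literature.Analysis.UnboundedOperators.HeatExtensionJointSmooth
import Literature.Analysis.FluidPDE.PineauVicolCylinderRegularity
import Summits.NavierStokesRegularity.NavierStokesRegularity.Theorems.QuantisedSymmetryPolyhedralDssProfileExistsStubClassicalOfOseenMildPast
import HarnessLib

/-!
# The blow-up-time velocity trace — crux stmt-NavierStokesRegularity-1404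
  (`QuantisedSymmetry.PolyhedralDssProfileExists`), line polyhedral_cell, stub stub_blowupTrace (N18)

Registered stub `stub_blowupTrace` (`--supports stmt-NavierStokesRegularity-1404`): for a Type-I
ancient mild field `V` in the Oseen gauge (`IsTypeIAncientMild C V`) with `HasTypeIDecay C₀ V`, the
trace `V₀(x) = lim_{t↑0} V(t,x)` exists at every `x ≠ 0`, is continuous off `0`, `‖x‖‖V₀ x‖ ≤ C₀`,
and it is DSS-homogeneous of degree `−1` / `g`-equivariant when `V` is `c`-DSS / `g`-equivariant.
Proof sketch. EXISTENCE (`exists_tendsto_of_ne_zero`): with `s = −1`, `r = ‖x‖/2`, `B = ball 0 r`,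
split `V = 𝟙_{Bᶜ}V + 𝟙_B V`; `K` is bilinear and the supports are disjoint, so
`B¹ₛ(V,V) = B¹ₛ(𝟙_{Bᶜ}V,𝟙_{Bᶜ}V) + B¹ₛ(𝟙_B V,𝟙_B V)` and, by the Oseen formula (KNSS 2009 §4),
`V t x = e^{(t−s)Δ}V(s)(x) − B¹ₛ(far)(t)(x) − B¹ₛ(near)(t)(x)`. The free part is continuous up to
`t = 0` (joint smoothness of the caloric extension of a bounded datum); the far field is bounded by
`C₀/r` on the WHOLE slab `(s,0) × ℝ³`, so its Duhamel term is jointly continuous on `[s,0] × ℝ³`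
(`continuousOn_uncurry_oseenDuhamel`, KNSS (3.10)); the near field lives in `B`, at distance `≥ r`
from `x`, where `‖K(σ,x−y)[a,a]‖ ≤ C_K(σ+‖x−y‖²)⁻²‖a‖² ≤ C_K r⁻⁴ C₀²‖y‖⁻²` uniformly in `σ > 0`,
`τ < 0` (Koch–Tataru (14); `‖V(τ,y)‖ ≤ C₀/‖y‖`; `‖y‖⁻² ∈ L¹(B)`), and the slice integrals converge
as the kernel time `t − τ → −τ > 0` (`K` is jointly smooth on `(0,∞) × ℝ³`): dominated convergence on
`(s,0)`. CONTINUITY off `0`: the slices are uniformly Lipschitz on `ball x₀ (‖x₀‖/2)` (Pineau–Vicol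
2026, Lemma 7.1: `‖DV(t)‖ ≤ K max(‖x‖,√(−t))⁻²`, with the classical pressure of
`exists_isClassicalNSSolutionOn_Iio_of_isTypeIAncientMild`; mean value inequality) and Lipschitz
bounds pass to the limit; the Type-I bound, homogeneity (`V(t,cx) = c⁻¹V(t/c²,x)`, `t/c² ↑ 0`) and
equivariance pass to the limit by uniqueness of limits.
-/

noncomputable section

-- the summit namespace `…NavierStokesRegularity.NavierStokesRegularity…` is the tree convention (D-0017)
set_option linter.dupNamespace false

namespace Summit.NavierStokesRegularity.NavierStokesRegularity.Theorems.PolyhedralDssProfileExists.PolyhedralCell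

open MeasureTheory Set Function Filter Topology Metric Literature.Analysis Literature.Analysis.FluidPDE

variable {E : Type*} [NormedAddCommGroup E] [InnerProductSpace ℝ E] [FiniteDimensional ℝ E]
  [MeasurableSpace E] [BorelSpace E]

omit [InnerProductSpace ℝ E] [FiniteDimensional ℝ E] [MeasurableSpace E] [BorelSpace E] in
/-- A space–time Type-I bound forces `0 ≤ C₀` (evaluate at `(t, x) = (−1, 0)`). -/
theorem blowupTrace_const_nonneg {V : ℝ → E → E} {C₀ : ℝ} (hD : HasTypeIDecay C₀ V) : 0 ≤ C₀ := by
  simpa using (norm_nonneg (V (-1) 0)).trans (hD (-1) (by norm_num) 0)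

/-- **Continuity of the Oseen slice integral in the kernel time** at every `σ₀ > 0`, for bounded
a.e.-measurable `a, b` (dominated convergence: `K` is jointly smooth on `(0,∞) × E`, and dominated
for `σ > σ₀/2` by the integrable envelope `C M_a M_b (σ₀/2 + ‖x − y‖²)^{-(d+1)/2}`, KT (14)). -/
theorem continuousAt_integral_oseenKernel_time {a b : E → E} {Ma Mb : ℝ}
    (ham : AEStronglyMeasurable a volume) (hbm : AEStronglyMeasurable b volume)
    (ha : ∀ y, ‖a y‖ ≤ Ma) (hb : ∀ y, ‖b y‖ ≤ Mb) (x : E) {σ₀ : ℝ} (hσ₀ : 0 < σ₀) :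
    ContinuousAt (fun σ => ∫ y, oseenKernel σ (x - y) (a y) (b y)) σ₀ := by
  obtain ⟨C, hC, hK⟩ := exists_norm_oseenKernel_le (E := E)
  have hσ2 : 0 < σ₀ / 2 := half_pos hσ₀
  have hev : ∀ᶠ σ in 𝓝 σ₀, σ₀ / 2 < σ := Ioi_mem_nhds (half_lt_self hσ₀)
  have hMa : 0 ≤ Ma := (norm_nonneg _).trans (ha 0)
  have hMb : 0 ≤ Mb := (norm_nonneg _).trans (hb 0)
  refine continuousAt_of_dominated ?_ ?_ (((integrable_add_norm_sq_rpow_neg_half_succ (E := E)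
    hσ2).comp_sub_left x).const_mul (C * Ma * Mb)) (Eventually.of_forall fun y => ?_)
  · filter_upwards [hev] with σ hσ
    exact (integrable_oseenKernel_slice_of_bound (hσ2.trans hσ) ham hbm ha hb
      x).aestronglyMeasurable
  · filter_upwards [hev] with σ hσ
    refine Eventually.of_forall fun y => ?_
    refine (norm_oseenKernel_apply_le_weight hK hC.le (hσ2.trans hσ) ha hb x y).trans ?_
    refine mul_le_mul_of_nonneg_left ?_ (by positivity)
    exact Real.rpow_le_rpow_of_nonpos (by positivity) (by linarith) (neg_nonpos.2 (by positivity))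
  · have hat := (contDiffOn_oseenKernel_prod (a y) (b y)).continuousOn.continuousAt
      ((isOpen_Ioi.prod isOpen_univ).mem_nhds (mk_mem_prod hσ₀ (mem_univ (x - y))))
    exact hat.comp (f := fun σ : ℝ => ((σ, x - y) : ℝ × E))
      (continuous_id.prodMk continuous_const).continuousAt

section Truncations

variable {V : ℝ → E → E} {C : ℝ} {S : Set E}

/-- Truncated slices `𝟙_S V(τ)` of a Type-I ancient mild field are a.e. strongly measurable. -/
theorem aestronglyMeasurable_indicator_slice (hV : IsTypeIAncientMild C V) (hS : MeasurableSet S)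
    {τ : ℝ} (hτ : τ < 0) : AEStronglyMeasurable (S.indicator (V τ)) volume :=
  (hV.continuous_slice hτ).aestronglyMeasurable.indicator hS

/-- A truncated field is jointly a.e. strongly measurable on every slab `(s, T) × E`, `T ≤ 0`. -/
theorem aestronglyMeasurable_uncurry_indicator (hV : IsTypeIAncientMild C V)
    (hS : MeasurableSet S) {s T : ℝ} (hT : T ≤ 0) :
    AEStronglyMeasurable (uncurry fun τ => S.indicator (V τ))
      ((volume : Measure (ℝ × E)).restrict (Ioo s T ×ˢ univ)) := by
  have e : (uncurry fun τ => S.indicator (V τ)) = ((univ : Set ℝ) ×ˢ S).indicator (uncurry V) := by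
    funext ⟨τ, y⟩
    show S.indicator (V τ) y = ((univ : Set ℝ) ×ˢ S).indicator (uncurry V) (τ, y)
    by_cases hy : y ∈ S
    · rw [indicator_of_mem hy, indicator_of_mem (mk_mem_prod (mem_univ τ) hy)]; rfl
    · rw [indicator_of_notMem hy, indicator_of_notMem fun h => hy (mem_prod.1 h).2]
  rw [e]
  exact (hV.aestronglyMeasurable_uncurry hT).indicator (MeasurableSet.univ.prod hS)

/-- **Splitting the Duhamel term along a truncation**: for `s < t < 0` and a measurable `S`,
`B¹ₛ(V,V)(t)(x) = B¹ₛ(𝟙_{Sᶜ}V, 𝟙_{Sᶜ}V)(t)(x) + B¹ₛ(𝟙_S V, 𝟙_S V)(t)(x)`: the kernel is bilinear and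
the supports are disjoint, and all fields are bounded by `C/√(−t)` and jointly measurable on
`(s, t) × E`, so every integral converges absolutely. -/
theorem oseenDuhamel_eq_indicator_compl_add (hV : IsTypeIAncientMild C V) (hS : MeasurableSet S)
    (x : E) {s t : ℝ} (hst : s < t) (ht : t < 0) :
    oseenDuhamel 1 s V V t x =
      oseenDuhamel 1 s (fun τ => Sᶜ.indicator (V τ)) (fun τ => Sᶜ.indicator (V τ)) t x +
        oseenDuhamel 1 s (fun τ => S.indicator (V τ)) (fun τ => S.indicator (V τ)) t x := by
  have hM : 0 ≤ C / Real.sqrt (-t) := div_nonneg hV.nonneg (Real.sqrt_nonneg _)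
  have hbd : ∀ (S' : Set E), ∀ τ ∈ Ioo s t, ∀ y, ‖S'.indicator (V τ) y‖ ≤ C / Real.sqrt (-t) :=
    fun S' τ hτ y => (norm_indicator_le_norm_self _ _).trans (hV.norm_le_of_mem_Ioo ht hτ y)
  have hI : ∀ {S' : Set E}, MeasurableSet S' → IntegrableOn (fun τ => ∫ y,
      oseenKernel (1 * (t - τ)) (x - y) (S'.indicator (V τ) y) (S'.indicator (V τ) y)) (Ioo s t) :=
    fun hS' => integrableOn_integral_oseenKernel_duhamel one_pos
      (aestronglyMeasurable_uncurry_indicator hV hS' ht.le)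
      (aestronglyMeasurable_uncurry_indicator hV hS' ht.le) hM (hbd _) (hbd _) hst le_rfl x
  simp only [oseenDuhamel]
  rw [← integral_add (hI hS.compl) (hI hS)]
  refine setIntegral_congr_fun measurableSet_Ioo fun τ hτ => ?_
  have hτ0 : τ < 0 := hτ.2.trans ht
  have hσ : 0 < 1 * (t - τ) := by rw [one_mul]; exact sub_pos.2 hτ.2
  have hi : ∀ {S' : Set E}, MeasurableSet S' → Integrable fun y =>
      oseenKernel (1 * (t - τ)) (x - y) (S'.indicator (V τ) y) (S'.indicator (V τ) y) :=
    fun hS' => integrable_oseenKernel_slice_of_bound hσ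
      (aestronglyMeasurable_indicator_slice hV hS' hτ0)
      (aestronglyMeasurable_indicator_slice hV hS' hτ0)
      (fun y => hbd _ τ hτ y) (fun y => hbd _ τ hτ y) x
  rw [← integral_add (hi hS.compl) (hi hS)]
  refine integral_congr_ae (Eventually.of_forall fun y => ?_)
  by_cases hy : y ∈ S <;> simp [hy]

/-- **The free part is continuous up to `t = 0`**: `e^{(t−s)Δ}V(s)(x) → e^{(0−s)Δ}V(s)(x)`, `t ↑ 0`
(`s < 0`; the caloric extension of the bounded datum `V(s)` is jointly smooth on `(0, ∞) × E`). -/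
theorem tendsto_heatExtension_slice (hV : IsTypeIAncientMild C V) {s : ℝ} (hs : s < 0) (x : E) :
    Tendsto (fun t => UnboundedOperators.heatExtension (V s) (t - s) x) (𝓝[<] 0)
      (𝓝 (UnboundedOperators.heatExtension (V s) (0 - s) x)) := by
  haveI : CompleteSpace E := FiniteDimensional.complete ℝ E
  have hmem : MemLp (V s) ⊤ volume := memLp_top_of_bound (hV.aestronglyMeasurable_slice hs)
    (C / Real.sqrt (-s)) (Eventually.of_forall fun y => hV.norm_le hs y)
  have hq : ((0 - s, x) : ℝ × E) ∈ Ioi (0 : ℝ) ×ˢ (univ : Set E) :=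
    mk_mem_prod (by simp only [mem_Ioi]; linarith) (mem_univ _)
  have hat := (UnboundedOperators.contDiffOn_heatExtension_prod hmem
    le_top).continuousOn.continuousAt ((isOpen_Ioi.prod isOpen_univ).mem_nhds hq)
  have hφ : Tendsto (fun t : ℝ => ((t - s, x) : ℝ × E)) (𝓝 0) (𝓝 (0 - s, x)) :=
    ((continuous_id.sub continuous_const).prodMk continuous_const).tendsto 0
  exact (hat.tendsto.comp hφ).mono_left nhdsWithin_le_nhds

/-- **The far Duhamel term is continuous up to `t = 0`**: `𝟙_{‖y‖ ≥ r}V` is bounded by `C₀/r`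
(`‖V(τ,y)‖ ≤ C₀/(‖y‖ + √(−τ)) ≤ C₀/r`) and jointly measurable on the whole slab `(s, 0) × E`, so its
Duhamel term is jointly continuous on `[s, 0] × E` (`continuousOn_uncurry_oseenDuhamel`). -/
theorem tendsto_oseenDuhamel_indicator_compl_ball {C₀ : ℝ} (hV : IsTypeIAncientMild C V)
    (hD : HasTypeIDecay C₀ V) {r : ℝ} (hr : 0 < r) (x : E) {s : ℝ} (hs : s < 0) :
    Tendsto (fun t => oseenDuhamel 1 s (fun τ => (ball (0 : E) r)ᶜ.indicator (V τ))
        (fun τ => (ball (0 : E) r)ᶜ.indicator (V τ)) t x) (𝓝[<] 0)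
      (𝓝 (oseenDuhamel 1 s (fun τ => (ball (0 : E) r)ᶜ.indicator (V τ))
        (fun τ => (ball (0 : E) r)ᶜ.indicator (V τ)) 0 x)) := by
  have hC₀ := blowupTrace_const_nonneg hD
  have hmeas := aestronglyMeasurable_uncurry_indicator hV (measurableSet_ball (x := (0 : E))
    (ε := r)).compl (s := s) (T := 0) le_rfl
  have hbd : ∀ τ ∈ Ioo s 0, ∀ y, ‖(ball (0 : E) r)ᶜ.indicator (V τ) y‖ ≤ C₀ / r := by
    intro τ hτ y
    by_cases hy : y ∈ (ball (0 : E) r)ᶜ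
    · rw [indicator_of_mem hy]
      have hyr : r ≤ ‖y‖ := by simpa [mem_ball_zero_iff] using hy
      exact (hD τ hτ.2 y).trans (div_le_div_of_nonneg_left hC₀ hr
        (hyr.trans (le_add_of_nonneg_right (Real.sqrt_nonneg _))))
    · rw [indicator_of_notMem hy, norm_zero]; positivity
  have hcont := continuousOn_uncurry_oseenDuhamel one_pos (div_nonneg hC₀ hr.le) hmeas hmeas hbd hbd
  have hφ : Tendsto (fun t : ℝ => ((t, x) : ℝ × E)) (𝓝[<] 0) (𝓝[Icc s 0 ×ˢ univ] (0, x)) := by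
    refine tendsto_nhdsWithin_iff.2 ⟨?_, ?_⟩
    · exact ((continuous_id.prodMk continuous_const).tendsto 0).mono_left nhdsWithin_le_nhds
    · filter_upwards [Ioo_mem_nhdsLT hs] with t ht
      exact mk_mem_prod ⟨ht.1.le, ht.2.le⟩ (mem_univ _)
  exact (hcont (0, x) (mk_mem_prod ⟨hs.le, le_rfl⟩ (mem_univ _))).tendsto.comp hφ

end Truncations

section Near

variable {V : ℝ → EuclideanSpace ℝ (Fin 3) → EuclideanSpace ℝ (Fin 3)} {C C₀ : ℝ}

/-- **The near Duhamel term has a limit as `t ↑ 0`** (`x ≠ 0`, `r = ‖x‖/2`, `B = ball 0 r`). The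
slice integrals `∫ K(σ, x−y)[𝟙_B V(τ,y), 𝟙_B V(τ,y)] dy` are bounded by the constant
`A = C_K r⁻⁴ C₀² ∫_B ‖y‖⁻² dy` uniformly in `σ > 0`, `τ < 0` (the kernel is nonsingular at distance
`≥ r` from `x`, Koch–Tataru (14); `‖V(τ,y)‖ ≤ C₀/‖y‖`; `‖y‖⁻² ∈ L¹_loc(ℝ³)`), and converge as the
kernel time `t − τ → −τ > 0` (`continuousAt_integral_oseenKernel_time`); dominated convergence. -/
theorem tendsto_oseenDuhamel_indicator_ball (hV : IsTypeIAncientMild C V) (hD : HasTypeIDecay C₀ V)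
    {x : EuclideanSpace ℝ (Fin 3)} (hx : x ≠ 0) {s : ℝ} (hs : s < 0) :
    Tendsto (fun t => oseenDuhamel 1 s (fun τ => (ball 0 (‖x‖ / 2)).indicator (V τ))
        (fun τ => (ball 0 (‖x‖ / 2)).indicator (V τ)) t x) (𝓝[<] 0)
      (𝓝 (∫ τ in Ioo s 0, ∫ y, oseenKernel (1 * (0 - τ)) (x - y)
        ((ball 0 (‖x‖ / 2)).indicator (V τ) y) ((ball 0 (‖x‖ / 2)).indicator (V τ) y))) := by
  set r : ℝ := ‖x‖ / 2 with hr
  have hr0 : 0 < r := by rw [hr]; exact half_pos (norm_pos_iff.2 hx)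
  set Vn : ℝ → EuclideanSpace ℝ (Fin 3) → EuclideanSpace ℝ (Fin 3) :=
    fun τ => (ball 0 r).indicator (V τ) with hVn
  have hC₀ : 0 ≤ C₀ := blowupTrace_const_nonneg hD
  obtain ⟨Cₖ, hCₖ, hK⟩ := exists_norm_oseenKernel_le (E := EuclideanSpace ℝ (Fin 3))
  set e : ℝ := -(((Module.finrank ℝ (EuclideanSpace ℝ (Fin 3)) : ℝ) + 1) / 2) with he_def
  set k : ℝ → ℝ → EuclideanSpace ℝ (Fin 3) :=
    fun σ τ => ∫ y, oseenKernel σ (x - y) (Vn τ y) (Vn τ y) with hk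
  set g : EuclideanSpace ℝ (Fin 3) → ℝ := fun y =>
    Cₖ * (r ^ 2) ^ e * (C₀ ^ 2 * (ball 0 r).indicator (fun y => (‖y‖ ^ 2)⁻¹) y) with hg
  have hgi : Integrable g volume := by
    have h1 : IntegrableOn (fun y : EuclideanSpace ℝ (Fin 3) => (‖y‖ ^ 2)⁻¹) (ball 0 r) volume := by
      refine (NewtonPotentialHolder.integrableOn_ball_norm_rpow_neg (s := 2) (by norm_num)
        r).congr_fun (fun y _ => ?_) measurableSet_ball
      simp only [Real.rpow_neg (norm_nonneg _), Real.rpow_two]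
    exact ((h1.integrable_indicator measurableSet_ball).const_mul _).const_mul _
  have hA0 : 0 ≤ ∫ y, g y := integral_nonneg fun y =>
    mul_nonneg (mul_nonneg hCₖ.le (Real.rpow_nonneg (sq_nonneg _) _))
      (mul_nonneg (sq_nonneg _) (indicator_nonneg (fun z _ => by positivity) y))
  have hae : ∀ᵐ y ∂(volume : Measure (EuclideanSpace ℝ (Fin 3))), y ≠ 0 := by rw [ae_iff]; simp
  have hk_le : ∀ {σ : ℝ}, 0 < σ → ∀ {τ : ℝ}, τ < 0 → ‖k σ τ‖ ≤ ∫ y, g y := by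
    intro σ hσ τ hτ
    refine norm_integral_le_of_norm_le hgi ?_
    filter_upwards [hae] with y hy0
    by_cases hy : y ∈ ball 0 r
    · have hyn : 0 < ‖y‖ := norm_pos_iff.2 hy0
      have hyr : ‖y‖ < r := mem_ball_zero_iff.1 hy
      have hxy : r ≤ ‖x - y‖ := by have := norm_sub_norm_le x y; rw [hr] at hyr ⊢; linarith
      have hw : (σ + ‖x - y‖ ^ 2) ^ e ≤ (r ^ 2) ^ e :=
        Real.rpow_le_rpow_of_nonpos (by positivity) (by nlinarith) (by rw [he_def]; norm_num)
      have hVy : ‖V τ y‖ ≤ C₀ / ‖y‖ := (hD τ hτ y).trans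
        (div_le_div_of_nonneg_left hC₀ hyn (le_add_of_nonneg_right (Real.sqrt_nonneg _)))
      have hgy : g y = Cₖ * (r ^ 2) ^ e * (C₀ / ‖y‖) * (C₀ / ‖y‖) := by
        simp only [hg, indicator_of_mem hy]; field_simp
      rw [hgy, show Vn τ y = V τ y by simp only [hVn, indicator_of_mem hy]]
      exact (hK hσ (x - y) (V τ y) (V τ y)).trans (by gcongr)
    · rw [show Vn τ y = 0 by simp only [hVn, indicator_of_notMem hy], oseenKernel_zero_left,
        norm_zero, show g y = 0 by simp [hg, indicator_of_notMem hy]]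
  have hbd : ∀ {t : ℝ}, t < 0 → ∀ τ ∈ Ioo s t, ∀ y, ‖Vn τ y‖ ≤ C / Real.sqrt (-t) :=
    fun ht τ hτ y => (norm_indicator_le_norm_self _ _).trans (hV.norm_le_of_mem_Ioo ht hτ y)
  have hset : ∀ {t : ℝ}, t ≤ 0 → Iio t ∩ Ioo s 0 = Ioo s t := fun ht =>
    Set.ext fun τ => ⟨fun h => ⟨h.2.1, h.1⟩, fun h => ⟨h.2, h.1, h.2.trans_le ht⟩⟩
  have hrepr : ∀ {t : ℝ}, t ≤ 0 → oseenDuhamel 1 s Vn Vn t x =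
      ∫ τ, (Iio t).indicator (fun τ => k (1 * (t - τ)) τ) τ ∂(volume.restrict (Ioo s 0)) := by
    intro t ht
    rw [integral_indicator measurableSet_Iio, Measure.restrict_restrict measurableSet_Iio, hset ht]
    rfl
  have key : Tendsto (fun t => ∫ τ, (Iio t).indicator (fun τ => k (1 * (t - τ)) τ) τ
      ∂(volume.restrict (Ioo s 0))) (𝓝[<] 0)
      (𝓝 (∫ τ, k (1 * (0 - τ)) τ ∂(volume.restrict (Ioo s 0)))) := by
    refine tendsto_integral_filter_of_dominated_convergence (fun _ => ∫ y, g y) ?_ ?_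
      (integrableOn_const (hs := measure_Ioo_lt_top.ne)) ?_
    · filter_upwards [Ioo_mem_nhdsLT hs] with t ht
      refine (aestronglyMeasurable_indicator_iff measurableSet_Iio).2 ?_
      rw [Measure.restrict_restrict measurableSet_Iio, hset ht.2.le]
      exact (integrableOn_integral_oseenKernel_duhamel one_pos
        (aestronglyMeasurable_uncurry_indicator hV measurableSet_ball ht.2.le)
        (aestronglyMeasurable_uncurry_indicator hV measurableSet_ball ht.2.le)
        (div_nonneg hV.nonneg (Real.sqrt_nonneg _)) (hbd ht.2) (hbd ht.2) ht.1 le_rfl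
        x).aestronglyMeasurable
    · filter_upwards [Ioo_mem_nhdsLT hs] with t ht
      refine (ae_restrict_iff' measurableSet_Ioo).2 (Eventually.of_forall fun τ hτ => ?_)
      by_cases hτt : τ < t
      · rw [indicator_of_mem (mem_Iio.2 hτt)]
        exact hk_le (by rw [one_mul]; exact sub_pos.2 hτt) hτ.2
      · rw [indicator_of_notMem (by simpa using hτt), norm_zero]
        exact hA0
    · refine (ae_restrict_iff' measurableSet_Ioo).2 (Eventually.of_forall fun τ hτ => ?_)
      have h0 : 0 < 1 * (0 - τ) := by rw [one_mul]; linarith [hτ.2]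
      have hcont : ContinuousAt (fun σ => k σ τ) (1 * (0 - τ)) :=
        continuousAt_integral_oseenKernel_time
          (aestronglyMeasurable_indicator_slice hV measurableSet_ball hτ.2)
          (aestronglyMeasurable_indicator_slice hV measurableSet_ball hτ.2)
          (fun y => (norm_indicator_le_norm_self _ _).trans (hV.norm_le hτ.2 y))
          (fun y => (norm_indicator_le_norm_self _ _).trans (hV.norm_le hτ.2 y)) x h0
      have hφ : Tendsto (fun t : ℝ => 1 * (t - τ)) (𝓝 0) (𝓝 (1 * (0 - τ))) :=
        (continuous_const.mul (continuous_id.sub continuous_const)).tendsto 0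
      refine ((hcont.tendsto.comp hφ).mono_left nhdsWithin_le_nhds).congr' ?_
      filter_upwards [Ioo_mem_nhdsLT hτ.2] with t ht
      simp only [Function.comp_apply, indicator_of_mem (mem_Iio.2 ht.1)]
  refine key.congr' ?_
  filter_upwards [Ioo_mem_nhdsLT hs] with t ht
  exact (hrepr ht.2.le).symm

/-- **Existence of the blow-up-time limit at `x ≠ 0`.** With `s = −1`, `r = ‖x‖/2`, `B = ball 0 r`:
`V t x = e^{(t−s)Δ}V(s)(x) − B¹ₛ(𝟙_{Bᶜ}V, 𝟙_{Bᶜ}V)(t)(x) − B¹ₛ(𝟙_B V, 𝟙_B V)(t)(x)` for `s < t < 0`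
(Oseen formula, `oseenDuhamel_eq_indicator_compl_add`), and the three terms converge as `t ↑ 0`. -/
theorem exists_tendsto_of_ne_zero (hV : IsTypeIAncientMild C V) (hD : HasTypeIDecay C₀ V)
    {x : EuclideanSpace ℝ (Fin 3)} (hx : x ≠ 0) :
    ∃ L : EuclideanSpace ℝ (Fin 3), Tendsto (fun t => V t x) (𝓝[<] 0) (𝓝 L) := by
  have hs : (-1 : ℝ) < 0 := by norm_num
  have h2 := tendsto_oseenDuhamel_indicator_compl_ball hV hD (half_pos (norm_pos_iff.2 hx)) x hs
  refine ⟨_, ((tendsto_heatExtension_slice hV hs x).sub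
    (h2.add (tendsto_oseenDuhamel_indicator_ball hV hD hx hs))).congr' ?_⟩
  filter_upwards [Ioo_mem_nhdsLT hs] with t ht
  rw [hV.mild_eq_heatExtension ht.1 ht.2 x,
    oseenDuhamel_eq_indicator_compl_add hV measurableSet_ball x ht.1 ht.2]

end Near

/-- **Stub `stub_blowupTrace` (N18): the blow-up-time trace of a Type-I ancient solution.** For a
Type-I ancient mild field `V` in the Oseen gauge with `HasTypeIDecay C₀ V` there is `V₀ : ℝ³ → ℝ³`
(`V₀ 0 = 0`) with `V(t, x) → V₀(x)` as `t ↑ 0` for every `x ≠ 0` (`exists_tendsto_of_ne_zero`);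
`V₀` is continuous on `ℝ³ ∖ {0}` (uniform Lipschitz bounds of the slices on `ball x₀ (‖x₀‖/2)`,
Pineau–Vicol 2026 Lemma 7.1 `PineauVicol2026.exists_forall_iteratedFDeriv_le_of_typeI 1 C₀` with
the classical pressure of `exists_isClassicalNSSolutionOn_Iio_of_isTypeIAncientMild`, the mean
value inequality, passed to the limit); `‖x‖ ‖V₀ x‖ ≤ C₀`; `V₀(cx) = c⁻¹ V₀(x)` for `c`-DSS `V`
(`V(t, cx) = c⁻¹ V(t/c², x)`, `t/c² ↑ 0`, uniqueness of limits); `g`-equivariance likewise. -/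
theorem stub_blowupTrace :
    ∀ (V : ℝ → EuclideanSpace ℝ (Fin 3) → EuclideanSpace ℝ (Fin 3)) (C C₀ : ℝ),
      IsTypeIAncientMild C V → HasTypeIDecay C₀ V →
      ∃ V₀ : EuclideanSpace ℝ (Fin 3) → EuclideanSpace ℝ (Fin 3),
        V₀ 0 = 0 ∧ ContinuousOn V₀ {x | x ≠ 0} ∧
        (∀ x, x ≠ 0 → Tendsto (fun t => V t x) (𝓝[<] 0) (𝓝 (V₀ x))) ∧
        (∀ x, ‖x‖ * ‖V₀ x‖ ≤ C₀) ∧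
        (∀ c : ℝ, 1 < c → IsDiscretelySelfSimilar c V → ∀ x, V₀ (c • x) = c⁻¹ • V₀ x) ∧
        (∀ g : EuclideanSpace ℝ (Fin 3) ≃ₗᵢ[ℝ] EuclideanSpace ℝ (Fin 3),
          (∀ t x, V t (g x) = g (V t x)) → ∀ x, V₀ (g x) = g (V₀ x)) := by
  intro V C C₀ hV hD
  classical
  have hC₀ : 0 ≤ C₀ := blowupTrace_const_nonneg hD
  have hlim : ∀ x : EuclideanSpace ℝ (Fin 3), x ≠ 0 →
      ∃ L : EuclideanSpace ℝ (Fin 3), Tendsto (fun t => V t x) (𝓝[<] 0) (𝓝 L) :=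
    fun x hx => exists_tendsto_of_ne_zero hV hD hx
  choose! L hL using hlim
  set V₀ : EuclideanSpace ℝ (Fin 3) → EuclideanSpace ℝ (Fin 3) :=
    fun x => if x = 0 then 0 else L x with hV₀
  have hT : ∀ x, x ≠ 0 → Tendsto (fun t => V t x) (𝓝[<] 0) (𝓝 (V₀ x)) :=
    fun x hx => by simpa only [hV₀, if_neg hx] using hL x hx
  refine ⟨V₀, if_pos rfl, ?_, hT, fun x => ?_, fun c hc hdss x => ?_, fun g hg x => ?_⟩
  rotate_left
  · -- the Type-I bound of the trace
    by_cases hx : x = 0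
    · rw [hx, norm_zero, zero_mul]; exact hC₀
    have hxn : 0 < ‖x‖ := norm_pos_iff.2 hx
    refine le_of_tendsto (tendsto_const_nhds.mul (hT x hx).norm) ?_
    filter_upwards [self_mem_nhdsWithin] with t ht
    have h' := (hD t ht x).trans
      (div_le_div_of_nonneg_left hC₀ hxn (le_add_of_nonneg_right (Real.sqrt_nonneg _)))
    rw [le_div_iff₀ hxn] at h'
    linarith
  · -- DSS-homogeneity of degree `-1`
    have hc0 : 0 < c := one_pos.trans hc
    by_cases hx : x = 0
    · simp [hV₀, hx]
    have hid : ∀ t, V t (c • x) = c⁻¹ • V (t / c ^ 2) x := fun t => by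
      have h := congrFun (congrFun hdss (t / c ^ 2)) x
      rw [nsRescale_apply, mul_div_cancel₀ _ (pow_ne_zero 2 hc0.ne')] at h
      rw [← h, smul_smul, inv_mul_cancel₀ hc0.ne', one_smul]
    have hφ : Tendsto (fun t : ℝ => t / c ^ 2) (𝓝[<] 0) (𝓝[<] 0) := by
      refine tendsto_nhdsWithin_iff.2 ⟨?_, ?_⟩
      · simpa using ((continuous_id.div_const (c ^ 2)).tendsto (0 : ℝ)).mono_left
          (nhdsWithin_le_nhds (s := Iio (0 : ℝ)))
      · filter_upwards [self_mem_nhdsWithin] with t ht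
        exact div_neg_of_neg_of_pos (mem_Iio.1 ht) (by positivity)
    have h2 : Tendsto (fun t => V t (c • x)) (𝓝[<] 0) (𝓝 (c⁻¹ • V₀ x)) := by
      rw [show (fun t => V t (c • x)) = fun t => c⁻¹ • V (t / c ^ 2) x from funext hid]
      exact ((hT x hx).comp hφ).const_smul c⁻¹
    exact tendsto_nhds_unique (hT _ (smul_ne_zero hc0.ne' hx)) h2
  · -- equivariance
    by_cases hx : x = 0
    · simp [hV₀, hx]
    have hgx : g x ≠ 0 := fun h => hx (g.injective (by rw [h, g.map_zero]))
    have h2 : Tendsto (fun t => V t (g x)) (𝓝[<] 0) (𝓝 (g (V₀ x))) := by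
      rw [show (fun t => V t (g x)) = fun t => g (V t x) from funext fun t => hg t x]
      exact (g.continuous.tendsto _).comp (hT x hx)
    exact tendsto_nhds_unique (hT _ hgx) h2
  · -- continuity off the origin: uniform Lipschitz bounds on `ball x₀ (‖x₀‖/2)`
    obtain ⟨p, hp⟩ := exists_isClassicalNSSolutionOn_Iio_of_isTypeIAncientMild hV
    obtain ⟨K, hK0, hK⟩ := PineauVicol2026.exists_forall_iteratedFDeriv_le_of_typeI 1 C₀
    have hKV := hK V p hp (fun t ht y => hD t ht y)
    intro x₀ hx₀
    have hx₀n : 0 < ‖x₀‖ := norm_pos_iff.2 hx₀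
    set ρ : ℝ := ‖x₀‖ / 2 with hρ
    have hρ0 : 0 < ρ := by rw [hρ]; positivity
    have hball : ∀ y ∈ ball x₀ ρ, ρ < ‖y‖ := fun y hy => by
      have h1 := norm_sub_norm_le x₀ y
      rw [norm_sub_rev] at h1; rw [mem_ball_iff_norm] at hy; rw [hρ] at hy ⊢; linarith
    have hball0 : ∀ y ∈ ball x₀ ρ, y ≠ 0 := fun y hy h => by
      have := hball y hy; rw [h, norm_zero] at this; linarith
    set Lip : ℝ := K * ρ⁻¹ ^ (1 + 1) with hLip
    have hLs : ∀ t < 0, ∀ y ∈ ball x₀ ρ, ∀ y' ∈ ball x₀ ρ, ‖V t y - V t y'‖ ≤ Lip * ‖y - y'‖ := by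
      intro t ht y hy y' hy'
      refine (convex_ball x₀ ρ).norm_image_sub_le_of_norm_fderiv_le (𝕜 := ℝ) (f := V t)
        (fun z _ => ((hV.contDiff_slice ht).differentiable (by simp)).differentiableAt)
        (fun z hz => ?_) hy' hy
      rw [← norm_iteratedFDeriv_zero (𝕜 := ℝ) (f := fderiv ℝ (V t)), norm_iteratedFDeriv_fderiv]
      refine (hKV t ht z).trans ?_
      have := inv_anti₀ hρ0 ((hball z hz).le.trans (le_max_left ‖z‖ (Real.sqrt (-t))))
      rw [hLip]
      gcongr
    have hL0 : ∀ y ∈ ball x₀ ρ, ‖V₀ y - V₀ x₀‖ ≤ Lip * ‖y - x₀‖ := fun y hy =>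
      le_of_tendsto ((hT y (hball0 y hy)).sub (hT x₀ hx₀)).norm (by
        filter_upwards [self_mem_nhdsWithin] with t ht
        exact hLs t ht y hy x₀ (mem_ball_self hρ0))
    refine ContinuousAt.continuousWithinAt ?_
    rw [ContinuousAt, tendsto_iff_norm_sub_tendsto_zero]
    refine squeeze_zero' (Eventually.of_forall fun y => norm_nonneg _)
      (g := fun y => Lip * ‖y - x₀‖) ?_ ?_
    · filter_upwards [ball_mem_nhds x₀ hρ0] with y hy using hL0 y hy
    · simpa using (tendsto_const_nhds (x := Lip)).mul (tendsto_norm_sub_self x₀)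

end Summit.NavierStokesRegularity.NavierStokesRegularity.Theorems.PolyhedralDssProfileExists.PolyhedralCell
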